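import Literature.NumberTheory.Automorphic.OpenBruhatCellGL
import HarnessLib

/-!
# Sections of `Ind_P^G σ'` supported on the open Bruhat cell

Topic `NumberTheory/Automorphic`. Let `F` be a non-archimedean local field, `c` a monotone block
labelling, `P = P_c ≤ GL_n(F)`, `σ'` a smooth representation of `P`, and `w₀`, `N'`, `A'` as in
`OpenBruhatCellGL` (the open cell is `P w₀ N'` with unique coordinates). For a compact open
subgroup `K` of `N'` and a vector `w` we construct the element

* `cellSection hc hσ' K hKo hKc w ∈ Ind_P^G σ'` (`Representation.SmoothInd`): the function
  `p w₀ n' ↦ 1_K(n') σ'(p) w` on the open cell, `0` off it,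

and prove: it is a smooth vector (`exists_congruenceGL_forall_cellSectionFun_mul`: right invariant
under a principal congruence subgroup — by the Iwahori factorisation of `K_γ` with respect to
`(P_c, N_c⁻)`, uniformly small conjugates `n' k n'⁻¹` for `n'` in the compact `K`, and the
smoothness of `w`), it vanishes on the complement `cellLT c w₀` of the open cell
(`cellSection_mem_vanishingOn`), it is linear in `w`, and its right translates are again of this
form: by `n₀ ∈ N'` (`toFun_smoothIndRep_radical_cellSection`) and by `m ∈ A'`
(`smoothIndRep_levi_cellSection`: `m · Φ_{K,w} = Φ_{m K m⁻¹, σ'(w₀ m w₀⁻¹) w}`).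

These are the "standard sections" of the big cell (Bernstein–Zelevinsky 1976, §2.21–2.25;
1977, §5–6, the open orbit of the geometric lemma), specialised to `U_n`-orbits. Definitions
(`cellSectionFun`, `cellSection`, `radicalConj`) have bodies; no named fact.

## References

* I. N. Bernstein, A. V. Zelevinsky, *Induced representations of reductive `p`-adic groups I*,
  Ann. Sci. ÉNS 10 (1977), §5–6. [BernsteinZelevinskyASENS1977]
* I. N. Bernstein, A. V. Zelevinsky, *Representations of the group GL(n, F) where F is a
  non-archimedean local field*, Russian Math. Surveys 31:3 (1976), §2.21–2.25, §3.13 (Iwahori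
  factorisation). [BernsteinZelevinskyRMS1976]
-/

open scoped Pointwise
open Matrix OrderDual Topology ValuativeRel

namespace Literature.NumberTheory.Automorphic

section Sections

variable {F : Type*} [Field F] [ValuativeRel F] [TopologicalSpace F] [IsNonarchimedeanLocalField F]
  {n : ℕ} {α : Type*} [LinearOrder α] [Fintype α] {c : Fin n → α}
  {W : Type*} [AddCommGroup W] [Module ℂ W]
  (σ' : Representation ℂ ↥(standardParabolicGL F c) W)

/-! ### The function `p w₀ n' ↦ 1_S(n') σ'(p) w` -/

/-- The function `g ↦ 1_S(n') σ'(p) w` for `g = p w₀ n'` on the open cell (`0` off the cell),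
for a subset `S ⊆ N'`. [folklore] -/
noncomputable def cellSectionFun (hc : Monotone c) (S : Set ↥(oppositeCellRadical (K := F) c)) (w : W) :
    GL (Fin n) F → W :=
  fun g => by
    classical
    exact if hg : g ∈ parabolicDoubleCoset (K := F) c Fin.revPerm then
      (if (⟨openCellN hc hg, openCellN_mem hc hg⟩ : ↥(oppositeCellRadical (K := F) c)) ∈ S then
        σ' ⟨openCellP hc hg, openCellP_mem hc hg⟩ w else 0)
    else 0

variable {σ'}

omit [ValuativeRel F] [TopologicalSpace F] [IsNonarchimedeanLocalField F] in
/-- Off the open cell the function vanishes. [folklore] -/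
lemma cellSectionFun_of_not_mem (hc : Monotone c) (S : Set ↥(oppositeCellRadical (K := F) c)) (w : W)
    {g : GL (Fin n) F} (hg : g ∉ parabolicDoubleCoset (K := F) c Fin.revPerm) :
    cellSectionFun σ' hc S w g = 0 := by
  simp [cellSectionFun, hg]

omit [ValuativeRel F] [TopologicalSpace F] [IsNonarchimedeanLocalField F] in
/-- **Value on the open cell, inside `S`**: `Φ_{S,w}(p w₀ n') = σ'(p) w` for `n' ∈ S`. [folklore] -/
theorem cellSectionFun_eq_of_mem (hc : Monotone c) {S : Set ↥(oppositeCellRadical (K := F) c)}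
    (w : W) {p n' : GL (Fin n) F} (hp : p ∈ standardParabolicGL F c)
    (hn' : n' ∈ oppositeCellRadical (K := F) c) (hS : (⟨n', hn'⟩ : ↥(oppositeCellRadical (K := F) c)) ∈ S) :
    cellSectionFun σ' hc S w (p * permGL Fin.revPerm * n') = σ' ⟨p, hp⟩ w := by
  classical
  have hg := parabolic_mul_w₀_mul_mem hc hp hn'
  obtain ⟨hP, hN⟩ := openCellP_openCellN_eq hc hp hn' hg
  have h1 : (⟨openCellN hc hg, openCellN_mem hc hg⟩ : ↥(oppositeCellRadical (K := F) c)) = ⟨n', hn'⟩ :=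
    Subtype.ext hN
  have h2 : (⟨openCellP hc hg, openCellP_mem hc hg⟩ : ↥(standardParabolicGL F c)) = ⟨p, hp⟩ :=
    Subtype.ext hP
  simp only [cellSectionFun, hg, dite_true, h1, hS, ite_true, h2]

omit [ValuativeRel F] [TopologicalSpace F] [IsNonarchimedeanLocalField F] in
/-- **Value on the open cell, outside `S`**: `Φ_{S,w}(p w₀ n') = 0` for `n' ∉ S`. [folklore] -/
theorem cellSectionFun_eq_zero_of_not_mem (hc : Monotone c) {S : Set ↥(oppositeCellRadical (K := F) c)}
    (w : W) {p n' : GL (Fin n) F} (hp : p ∈ standardParabolicGL F c)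
    (hn' : n' ∈ oppositeCellRadical (K := F) c) (hS : (⟨n', hn'⟩ : ↥(oppositeCellRadical (K := F) c)) ∉ S) :
    cellSectionFun σ' hc S w (p * permGL Fin.revPerm * n') = 0 := by
  classical
  have hg := parabolic_mul_w₀_mul_mem hc hp hn'
  obtain ⟨-, hN⟩ := openCellP_openCellN_eq hc hp hn' hg
  have h1 : (⟨openCellN hc hg, openCellN_mem hc hg⟩ : ↥(oppositeCellRadical (K := F) c)) = ⟨n', hn'⟩ :=
    Subtype.ext hN
  simp only [cellSectionFun, hg, dite_true, h1, hS, ite_false]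

omit [ValuativeRel F] [TopologicalSpace F] [IsNonarchimedeanLocalField F] in
/-- The value at a point `g` of the open cell in terms of its coordinates. [folklore] -/
theorem cellSectionFun_eq_of_mem_cell (hc : Monotone c) {S : Set ↥(oppositeCellRadical (K := F) c)}
    (w : W) {g : GL (Fin n) F} (hg : g ∈ parabolicDoubleCoset (K := F) c Fin.revPerm)
    (hS : (⟨openCellN hc hg, openCellN_mem hc hg⟩ : ↥(oppositeCellRadical (K := F) c)) ∈ S) :
    cellSectionFun σ' hc S w g = σ' ⟨openCellP hc hg, openCellP_mem hc hg⟩ w := by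
  conv_lhs => rw [← openCellP_mul_w₀_mul_openCellN hc hg]
  exact cellSectionFun_eq_of_mem hc w (openCellP_mem hc hg) (openCellN_mem hc hg) hS

omit [ValuativeRel F] [TopologicalSpace F] [IsNonarchimedeanLocalField F] in
/-- The value at a point `g` of the open cell whose `N'`-coordinate is outside `S` is `0`.
[folklore] -/
theorem cellSectionFun_eq_zero_of_mem_cell (hc : Monotone c) {S : Set ↥(oppositeCellRadical (K := F) c)}
    (w : W) {g : GL (Fin n) F} (hg : g ∈ parabolicDoubleCoset (K := F) c Fin.revPerm)
    (hS : (⟨openCellN hc hg, openCellN_mem hc hg⟩ : ↥(oppositeCellRadical (K := F) c)) ∉ S) :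
    cellSectionFun σ' hc S w g = 0 := by
  conv_lhs => rw [← openCellP_mul_w₀_mul_openCellN hc hg]
  exact cellSectionFun_eq_zero_of_not_mem hc w (openCellP_mem hc hg) (openCellN_mem hc hg) hS

omit [ValuativeRel F] [TopologicalSpace F] [IsNonarchimedeanLocalField F] in
/-- **Left equivariance**: `Φ(p₀ g) = σ'(p₀) Φ(g)` for `p₀ ∈ P_c`. [folklore] -/
theorem cellSectionFun_parabolic_mul (hc : Monotone c) (S : Set ↥(oppositeCellRadical (K := F) c)) (w : W)
    (p₀ : ↥(standardParabolicGL F c)) (g : GL (Fin n) F) :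
    cellSectionFun σ' hc S w ((p₀ : GL (Fin n) F) * g) = σ' p₀ (cellSectionFun σ' hc S w g) := by
  classical
  by_cases hg : g ∈ parabolicDoubleCoset (K := F) c Fin.revPerm
  · have hdec := openCellP_mul_w₀_mul_openCellN hc hg
    have hpq : (p₀ : GL (Fin n) F) * openCellP hc hg ∈ standardParabolicGL F c :=
      Subgroup.mul_mem _ p₀.2 (openCellP_mem hc hg)
    have e : (p₀ : GL (Fin n) F) * g = (p₀ : GL (Fin n) F) * openCellP hc hg * permGL Fin.revPerm * openCellN hc hg := by
      conv_lhs => rw [← hdec]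
      simp only [mul_assoc]
    by_cases hS : (⟨openCellN hc hg, openCellN_mem hc hg⟩ : ↥(oppositeCellRadical (K := F) c)) ∈ S
    · rw [e, cellSectionFun_eq_of_mem hc w hpq (openCellN_mem hc hg) hS,
        cellSectionFun_eq_of_mem_cell hc w hg hS, ← Module.End.mul_apply, ← map_mul]
      rfl
    · rw [e, cellSectionFun_eq_zero_of_not_mem hc w hpq (openCellN_mem hc hg) hS,
        cellSectionFun_eq_zero_of_mem_cell hc w hg hS, map_zero]
  · have hg' : (p₀ : GL (Fin n) F) * g ∉ parabolicDoubleCoset (K := F) c Fin.revPerm := fun h => hg (by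
      have := parabolic_mul_mem_parabolicDoubleCoset_rev (K := F) (c := c) h (Subgroup.inv_mem _ p₀.2)
      rwa [inv_mul_cancel_left] at this)
    rw [cellSectionFun_of_not_mem hc S w hg, cellSectionFun_of_not_mem hc S w hg', map_zero]

omit [ValuativeRel F] [TopologicalSpace F] [IsNonarchimedeanLocalField F] in
/-- The function is additive in `w`. [folklore] -/
lemma cellSectionFun_add (hc : Monotone c) (S : Set ↥(oppositeCellRadical (K := F) c)) (w₁ w₂ : W) :
    cellSectionFun σ' hc S (w₁ + w₂) = cellSectionFun σ' hc S w₁ + cellSectionFun σ' hc S w₂ := by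
  classical
  funext g
  simp only [cellSectionFun, Pi.add_apply]
  split_ifs <;> simp [map_add]

omit [ValuativeRel F] [TopologicalSpace F] [IsNonarchimedeanLocalField F] in
/-- The function is homogeneous in `w`. [folklore] -/
lemma cellSectionFun_smul (hc : Monotone c) (S : Set ↥(oppositeCellRadical (K := F) c)) (a : ℂ) (w : W) :
    cellSectionFun σ' hc S (a • w) = a • cellSectionFun σ' hc S w := by
  classical
  funext g
  simp only [cellSectionFun, Pi.smul_apply]
  split_ifs <;> simp [map_smul]

/-! ### Smoothness: right invariance under a principal congruence subgroup -/

/-- An open subgroup of a subgroup `H ≤ GL_n(F)` (for the subspace topology) contains the trace of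
some principal congruence subgroup. [folklore] -/
lemma exists_congruenceGL_subset_of_isOpen {H : Subgroup (GL (Fin n) F)} {T : Subgroup ↥H}
    (hT : IsOpen (T : Set ↥H)) :
    ∃ γ : (ValueGroupWithZero F)ˣ, ∀ h : ↥H, (h : GL (Fin n) F) ∈ congruenceGL n (γ : ValueGroupWithZero F) → h ∈ T := by
  obtain ⟨O, hO, hOT⟩ := isOpen_induced_iff.1 hT
  have h1 : (1 : GL (Fin n) F) ∈ O := by
    have : (1 : ↥H) ∈ (Subtype.val ⁻¹' O : Set ↥H) := by rw [hOT]; exact T.one_mem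
    exact this
  obtain ⟨γ, hγ⟩ := exists_congruenceGL_subset (hO.mem_nhds h1)
  refine ⟨γ, fun h hh => ?_⟩
  have : h ∈ (Subtype.val ⁻¹' O : Set ↥H) := hγ hh
  rwa [hOT] at this

/-- **Uniformly small conjugates**: for a compact `C ⊆ GL_n(F)` and `γ₀ ≠ 0` there is `γ` such that
`x k x⁻¹ ∈ K_{γ₀}` for all `x ∈ C`, `k ∈ K_γ` (tube lemma for the conjugation map). [folklore] -/
lemma exists_congruenceGL_conj_subset {C : Set (GL (Fin n) F)} (hC : IsCompact C)
    {γ₀ : ValueGroupWithZero F} (hγ₀ : γ₀ ≠ 0) :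
    ∃ γ : (ValueGroupWithZero F)ˣ, ∀ x ∈ C, ∀ k ∈ congruenceGL n (γ : ValueGroupWithZero F),
      x * k * x⁻¹ ∈ congruenceGL n γ₀ := by
  have hcont : Continuous fun q : GL (Fin n) F × GL (Fin n) F => q.1 * q.2 * q.1⁻¹ := by
    fun_prop
  have hO : IsOpen ((fun q : GL (Fin n) F × GL (Fin n) F => q.1 * q.2 * q.1⁻¹) ⁻¹'
      (congruenceGL n γ₀ : Set (GL (Fin n) F))) := (isOpen_congruenceGL hγ₀).preimage hcont
  have hsub : C ×ˢ ({1} : Set (GL (Fin n) F)) ⊆ (fun q : GL (Fin n) F × GL (Fin n) F => q.1 * q.2 * q.1⁻¹) ⁻¹'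
      (congruenceGL n γ₀ : Set (GL (Fin n) F)) := by
    rintro ⟨x, y⟩ ⟨-, hy⟩
    rw [Set.mem_singleton_iff] at hy
    subst hy
    show x * 1 * x⁻¹ ∈ (congruenceGL n γ₀ : Set (GL (Fin n) F))
    rw [mul_one, mul_inv_cancel]
    exact Subgroup.one_mem _
  obtain ⟨u, v, -, hv, hCu, h1v, huv⟩ := generalized_tube_lemma hC isCompact_singleton hO hsub
  obtain ⟨γ, hγ⟩ := exists_congruenceGL_subset (hv.mem_nhds (h1v (Set.mem_singleton 1)))
  refine ⟨γ, fun x hx k hk => ?_⟩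
  have hk' : k ∈ v := hγ (SetLike.mem_coe.2 hk)
  have hmem : (x, k) ∈ u ×ˢ v := Set.mk_mem_prod (hCu hx) hk'
  have h2 := huv hmem
  rw [Set.mem_preimage, SetLike.mem_coe] at h2
  exact h2

variable (σ')

/-- **Smoothness of the standard sections.** For `σ'` smooth, `K` a compact open subgroup of `N'`
and `w ∈ W` there is a principal congruence subgroup `K_γ` under which `Φ_{K,w}` is right
invariant. (Iwahori factorisation `K_{γ₀} = (P_c ∩ K_{γ₀})(N_c⁻ ∩ K_{γ₀})`; `w₀` normalises
`K_{γ₀}`; `w₀⁻¹ N_c⁻ w₀ = N'`.) [cite: BernsteinZelevinskyRMS1976, §3.13] -/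
theorem exists_congruenceGL_forall_cellSectionFun_mul (hc : Monotone c) (hσ' : σ'.IsSmooth)
    (K : Subgroup ↥(oppositeCellRadical (K := F) c)) (hKo : IsOpen (K : Set ↥(oppositeCellRadical (K := F) c)))
    (hKc : IsCompact (K : Set ↥(oppositeCellRadical (K := F) c))) (w : W) :
    ∃ γ : (ValueGroupWithZero F)ˣ, ∀ k ∈ congruenceGL n (γ : ValueGroupWithZero F), ∀ g,
      cellSectionFun σ' hc (K : Set _) w (g * k) = cellSectionFun σ' hc (K : Set _) w g := by
  classical
  -- `γ₁`: `P_c ∩ K_{γ₁}` fixes `w`; `γ₂`: `N' ∩ K_{γ₂} ⊆ K`; `γ' < 1`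
  obtain ⟨γ₁, hγ₁⟩ := exists_congruenceGL_subset_of_isOpen (H := standardParabolicGL F c) (hσ' w)
  obtain ⟨γ₂, hγ₂⟩ := exists_congruenceGL_subset_of_isOpen (H := oppositeCellRadical (K := F) c) hKo
  obtain ⟨ϖ, hϖ0, hϖ1⟩ := exists_valuation_pos_lt_one (F := F)
  set γ₀ : ValueGroupWithZero F := min (min (γ₁ : ValueGroupWithZero F) (γ₂ : ValueGroupWithZero F))
    (valuation F ϖ) with hγ₀_def
  have hγ₀0 : γ₀ ≠ 0 := by
    refine (lt_min (lt_min ?_ ?_) ?_).ne' <;> refine pos_iff_ne_zero.2 ?_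
    · exact γ₁.ne_zero
    · exact γ₂.ne_zero
    · exact hϖ0
  have hγ₀1 : γ₀ < 1 := lt_of_le_of_lt (min_le_right _ _) hϖ1
  have hγ₀₁ : congruenceGL n γ₀ ≤ congruenceGL n (γ₁ : ValueGroupWithZero F) :=
    congruenceGL_mono ((min_le_left _ _).trans (min_le_left _ _))
  have hγ₀₂ : congruenceGL n γ₀ ≤ congruenceGL n (γ₂ : ValueGroupWithZero F) :=
    congruenceGL_mono ((min_le_left _ _).trans (min_le_right _ _))
  -- `γ`: conjugates by `K` of `K_γ` lie in `K_{γ₀}`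
  obtain ⟨γ, hγ⟩ := exists_congruenceGL_conj_subset (n := n) (hKc.image continuous_subtype_val) hγ₀0
  have hconj : ∀ n' : ↥(oppositeCellRadical (K := F) c), n' ∈ K →
      ∀ k ∈ congruenceGL n (γ : ValueGroupWithZero F), (n' : GL (Fin n) F) * k * (n' : GL (Fin n) F)⁻¹ ∈
        congruenceGL n γ₀ :=
    fun n' hn' k hk => hγ _ ⟨n', hn', rfl⟩ k hk
  have hw₀ : (permGL Fin.revPerm : GL (Fin n) F) ∈ glInt n F := permGL_mem_glInt _
  -- the key computation on the support `P w₀ K`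
  have key : ∀ (g k : GL (Fin n) F) (hg : g ∈ parabolicDoubleCoset (K := F) c Fin.revPerm),
      (⟨openCellN hc hg, openCellN_mem hc hg⟩ : ↥(oppositeCellRadical (K := F) c)) ∈ K →
      k ∈ congruenceGL n (γ : ValueGroupWithZero F) →
      ∃ (q l' : GL (Fin n) F) (hq : q ∈ standardParabolicGL F c) (hl' : l' ∈ oppositeCellRadical (K := F) c),
        σ' ⟨q, hq⟩ w = w ∧ (⟨l', hl'⟩ : ↥(oppositeCellRadical (K := F) c)) ∈ K ∧
        g * k = openCellP hc hg * q * permGL Fin.revPerm * (l' * openCellN hc hg) := by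
    intro g k hg hK hk
    set p := openCellP hc hg with hp_def
    set n' := openCellN hc hg with hn'_def
    have hk' : n' * k * n'⁻¹ ∈ congruenceGL n γ₀ := hconj ⟨n', openCellN_mem hc hg⟩ hK k hk
    have hk'' : permGL Fin.revPerm * (n' * k * n'⁻¹) * (permGL Fin.revPerm)⁻¹ ∈ congruenceGL n γ₀ :=
      conj_mem_congruenceGL hw₀ hk'
    obtain ⟨q, hqP, hqK, l, hlN, hlK, hql⟩ := exists_parabolic_mul_lower_of_mem_congruenceGL c hγ₀1 hk''
    have hl' : (permGL Fin.revPerm)⁻¹ * l * permGL Fin.revPerm ∈ oppositeCellRadical (K := F) c :=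
      inv_mul_mul_mem_oppositeCellRadical c hlN
    have hl'K : (permGL Fin.revPerm)⁻¹ * l * permGL Fin.revPerm ∈ congruenceGL n γ₀ := by
      have := conj_mem_congruenceGL (Subgroup.inv_mem _ hw₀) hlK
      rwa [inv_inv] at this
    refine ⟨q, (permGL Fin.revPerm)⁻¹ * l * permGL Fin.revPerm, hqP, hl', ?_, ?_, ?_⟩
    · exact (Representation.mem_stabilizerSubgroup _ _ _).1 (hγ₁ ⟨q, hqP⟩ (hγ₀₁ hqK))
    · exact hγ₂ ⟨_, hl'⟩ (hγ₀₂ hl'K)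
    · have hdec := openCellP_mul_w₀_mul_openCellN hc hg
      rw [← hp_def, ← hn'_def] at hdec
      calc g * k = p * permGL Fin.revPerm * n' * k := by rw [hdec]
        _ = p * (permGL Fin.revPerm * (n' * k * n'⁻¹) * (permGL Fin.revPerm)⁻¹) * permGL Fin.revPerm * n' := by
            group
        _ = p * (q * l) * permGL Fin.revPerm * n' := by rw [hql]
        _ = p * q * permGL Fin.revPerm * ((permGL Fin.revPerm)⁻¹ * l * permGL Fin.revPerm * n') := by group
  -- values agree on the support
  have hval : ∀ (g k : GL (Fin n) F) (hg : g ∈ parabolicDoubleCoset (K := F) c Fin.revPerm),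
      (⟨openCellN hc hg, openCellN_mem hc hg⟩ : ↥(oppositeCellRadical (K := F) c)) ∈ K →
      k ∈ congruenceGL n (γ : ValueGroupWithZero F) →
      cellSectionFun σ' hc (K : Set _) w (g * k) = cellSectionFun σ' hc (K : Set _) w g ∧
        ∃ hgk : g * k ∈ parabolicDoubleCoset (K := F) c Fin.revPerm,
          (⟨openCellN hc hgk, openCellN_mem hc hgk⟩ : ↥(oppositeCellRadical (K := F) c)) ∈ K := by
    intro g k hg hK hk
    obtain ⟨q, l', hq, hl', hqw, hl'K, hgk⟩ := key g k hg hK hk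
    have hpq : openCellP hc hg * q ∈ standardParabolicGL F c := Subgroup.mul_mem _ (openCellP_mem hc hg) hq
    have hln : l' * openCellN hc hg ∈ oppositeCellRadical (K := F) c :=
      Subgroup.mul_mem _ hl' (openCellN_mem hc hg)
    have hmem : g * k ∈ parabolicDoubleCoset (K := F) c Fin.revPerm := by
      rw [hgk]; exact parabolic_mul_w₀_mul_mem hc hpq hln
    have hcoord := openCellP_openCellN_eq hc hpq hln (hgk ▸ hmem)
    have hlnK : (⟨l' * openCellN hc hg, hln⟩ : ↥(oppositeCellRadical (K := F) c)) ∈ K := by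
      have : (⟨l' * openCellN hc hg, hln⟩ : ↥(oppositeCellRadical (K := F) c)) =
          ⟨l', hl'⟩ * ⟨openCellN hc hg, openCellN_mem hc hg⟩ := rfl
      rw [this]
      exact K.mul_mem hl'K hK
    refine ⟨?_, hmem, ?_⟩
    · rw [hgk, cellSectionFun_eq_of_mem hc w hpq hln hlnK, cellSectionFun_eq_of_mem_cell hc w hg hK]
      have : (⟨openCellP hc hg * q, hpq⟩ : ↥(standardParabolicGL F c)) =
          ⟨openCellP hc hg, openCellP_mem hc hg⟩ * ⟨q, hq⟩ := rfl
      rw [this, map_mul, Module.End.mul_apply, hqw]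
    · have h2 := hcoord.2
      -- `openCellN (g k) = l' n' ∈ K`
      have : (⟨openCellN hc hmem, openCellN_mem hc hmem⟩ : ↥(oppositeCellRadical (K := F) c)) =
          ⟨l' * openCellN hc hg, hln⟩ := by
        apply Subtype.ext
        show openCellN hc hmem = l' * openCellN hc hg
        convert h2 using 2
      rw [this]
      exact hlnK
  refine ⟨γ, fun k hk g => ?_⟩
  -- if `g k` lies in the support then so does `g = (g k) k⁻¹`, with the same `N'`-membership
  have back : ∀ (hgk : g * k ∈ parabolicDoubleCoset (K := F) c Fin.revPerm),
      (⟨openCellN hc hgk, openCellN_mem hc hgk⟩ : ↥(oppositeCellRadical (K := F) c)) ∈ K →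
      ∃ hg : g ∈ parabolicDoubleCoset (K := F) c Fin.revPerm,
        (⟨openCellN hc hg, openCellN_mem hc hg⟩ : ↥(oppositeCellRadical (K := F) c)) ∈ K := by
    intro hgk hKk
    obtain ⟨-, hgkk, hKgkk⟩ := hval (g * k) k⁻¹ hgk hKk (Subgroup.inv_mem _ hk)
    have hg : g ∈ parabolicDoubleCoset (K := F) c Fin.revPerm := by
      rwa [mul_inv_cancel_right] at hgkk
    refine ⟨hg, ?_⟩
    have : openCellN hc hgkk = openCellN hc hg := openCellN_congr hc (mul_inv_cancel_right g k) hgkk hg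
    simp only [this] at hKgkk
    exact hKgkk
  -- the value at `g k` vanishes unless `g k` is in the support
  have van : ∀ x : GL (Fin n) F, (∀ hx : x ∈ parabolicDoubleCoset (K := F) c Fin.revPerm,
      (⟨openCellN hc hx, openCellN_mem hc hx⟩ : ↥(oppositeCellRadical (K := F) c)) ∉ K) →
      cellSectionFun σ' hc (K : Set _) w x = 0 := by
    intro x hx
    by_cases hxc : x ∈ parabolicDoubleCoset (K := F) c Fin.revPerm
    · exact cellSectionFun_eq_zero_of_mem_cell hc w hxc (hx hxc)
    · exact cellSectionFun_of_not_mem hc _ w hxc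
  by_cases hg : g ∈ parabolicDoubleCoset (K := F) c Fin.revPerm
  · by_cases hK : (⟨openCellN hc hg, openCellN_mem hc hg⟩ : ↥(oppositeCellRadical (K := F) c)) ∈ K
    · exact (hval g k hg hK hk).1
    · rw [van g (fun hx => by
        have : openCellN hc hx = openCellN hc hg := openCellN_congr hc rfl hx hg
        simp only [this]; exact hK)]
      refine van (g * k) fun hgk hKk => hK ?_
      obtain ⟨hg', hK'⟩ := back hgk hKk
      have : openCellN hc hg' = openCellN hc hg := openCellN_congr hc rfl hg' hg
      simp only [this] at hK'
      exact hK'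
  · rw [cellSectionFun_of_not_mem hc _ w hg]
    refine van (g * k) fun hgk hKk => hg ?_
    obtain ⟨hg', -⟩ := back hgk hKk
    exact hg'

/-! ### The standard sections as elements of `Ind_P^G σ'` -/

/-- **The standard section** `Φ_{K,w} ∈ Ind_{P_c}^{GL_n} σ'` attached to a compact open subgroup `K` of
`N'` and `w ∈ W` (for `σ'` smooth): the function `p w₀ n' ↦ 1_K(n') σ'(p) w`, zero off the open
cell. (Bernstein–Zelevinsky 1976, §2.22–2.24: functions in `ind` supported on one coset chart.)
[cite: BernsteinZelevinskyRMS1976, §2.22] -/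
noncomputable def cellSection (hc : Monotone c) (hσ' : σ'.IsSmooth)
    (K : Subgroup ↥(oppositeCellRadical (K := F) c)) (hKo : IsOpen (K : Set ↥(oppositeCellRadical (K := F) c)))
    (hKc : IsCompact (K : Set ↥(oppositeCellRadical (K := F) c))) (w : W) :
    Representation.SmoothInd (standardParabolicGL F c) σ' :=
  ⟨⟨cellSectionFun σ' hc (K : Set _) w, (Representation.mem_indFun_iff _ _ _).2 fun p₀ g =>
      cellSectionFun_parabolic_mul hc (K : Set _) w p₀ g⟩, by
    show (Representation.indFun (standardParabolicGL F c) σ').IsSmoothVector _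
    obtain ⟨γ, hγ⟩ := exists_congruenceGL_forall_cellSectionFun_mul σ' hc hσ' K hKo hKc w
    refine Subgroup.isOpen_mono (H₁ := congruenceGL n (γ : ValueGroupWithZero F)) (fun k hk => ?_)
      (isOpen_congruenceGL γ.ne_zero)
    rw [Representation.mem_stabilizerSubgroup]
    exact Subtype.ext (funext fun g => hγ k hk g)⟩

/-- The underlying function of `Φ_{K,w}`. [folklore] -/
@[simp] lemma toFun_cellSection (hc : Monotone c) (hσ' : σ'.IsSmooth)
    (K : Subgroup ↥(oppositeCellRadical (K := F) c)) (hKo : IsOpen (K : Set ↥(oppositeCellRadical (K := F) c)))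
    (hKc : IsCompact (K : Set ↥(oppositeCellRadical (K := F) c))) (w : W) :
    (cellSection σ' hc hσ' K hKo hKc w).toFun = cellSectionFun σ' hc (K : Set _) w := rfl

/-- `Φ_{K,w}` vanishes on the closed complement `cellLT c w₀` of the open cell. [folklore] -/
theorem cellSection_mem_vanishingOn (hc : Monotone c) (hσ' : σ'.IsSmooth)
    (K : Subgroup ↥(oppositeCellRadical (K := F) c)) (hKo : IsOpen (K : Set ↥(oppositeCellRadical (K := F) c)))
    (hKc : IsCompact (K : Set ↥(oppositeCellRadical (K := F) c))) (w : W) :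
    cellSection σ' hc hσ' K hKo hKc w ∈
      vanishingOn (standardParabolicGL F c) σ' (cellLT (K := F) c Fin.revPerm) := by
  intro g hg
  rw [toFun_cellSection]
  exact cellSectionFun_of_not_mem hc _ w fun h =>
    Set.disjoint_left.1 (disjoint_cellLT_parabolicDoubleCoset (K := F) c hc Fin.revPerm) hg h

/-- `w ↦ Φ_{K,w}` as a linear map `W →ₗ Ind_P^G σ'`. [folklore] -/
noncomputable def cellSectionₗ (hc : Monotone c) (hσ' : σ'.IsSmooth)
    (K : Subgroup ↥(oppositeCellRadical (K := F) c)) (hKo : IsOpen (K : Set ↥(oppositeCellRadical (K := F) c)))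
    (hKc : IsCompact (K : Set ↥(oppositeCellRadical (K := F) c))) :
    W →ₗ[ℂ] Representation.SmoothInd (standardParabolicGL F c) σ' where
  toFun := cellSection σ' hc hσ' K hKo hKc
  map_add' w₁ w₂ := Representation.SmoothInd.ext (by
    simp only [toFun_cellSection, Representation.SmoothInd.toFun_add, cellSectionFun_add])
  map_smul' a w := Representation.SmoothInd.ext (by
    simp only [toFun_cellSection, Representation.SmoothInd.toFun_smul, cellSectionFun_smul, RingHom.id_apply])

/-- `cellSectionₗ … w = cellSection … w`. [folklore] -/
@[simp] lemma cellSectionₗ_apply (hc : Monotone c) (hσ' : σ'.IsSmooth)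
    (K : Subgroup ↥(oppositeCellRadical (K := F) c)) (hKo : IsOpen (K : Set ↥(oppositeCellRadical (K := F) c)))
    (hKc : IsCompact (K : Set ↥(oppositeCellRadical (K := F) c))) (w : W) :
    cellSectionₗ σ' hc hσ' K hKo hKc w = cellSection σ' hc hσ' K hKo hKc w := rfl

/-! ### Right translates by `N'` and by `A'` -/

/-- **Right translation by `r ∈ N'`**: `(r · Φ_{K,w})(p w₀ n') = Φ_{K,w}(p w₀ (n' r))`. [folklore] -/
theorem toFun_smoothIndRep_radical_cellSection (hc : Monotone c) (hσ' : σ'.IsSmooth)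
    (K : Subgroup ↥(oppositeCellRadical (K := F) c)) (hKo : IsOpen (K : Set ↥(oppositeCellRadical (K := F) c)))
    (hKc : IsCompact (K : Set ↥(oppositeCellRadical (K := F) c))) (w : W)
    (r : ↥(oppositeCellRadical (K := F) c)) (p n' : GL (Fin n) F) :
    (Representation.smoothIndRep (standardParabolicGL F c) σ' (r : GL (Fin n) F)
        (cellSection σ' hc hσ' K hKo hKc w)).toFun (p * permGL Fin.revPerm * n') =
      cellSectionFun σ' hc (K : Set _) w (p * permGL Fin.revPerm * (n' * (r : GL (Fin n) F))) := by
  rw [Representation.toFun_smoothIndRep_apply, toFun_cellSection, mul_assoc]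

/-- **Conjugation of `N'` by an element of the reversed parabolic** `P' ⊇ U_n ⊇ A'`, as a group
automorphism of `N'`. [folklore] -/
noncomputable def radicalConj {m : GL (Fin n) F} (hm : m ∈ standardParabolicGL F (⇑toDual ∘ revLabel c)) :
    ↥(oppositeCellRadical (K := F) c) ≃* ↥(oppositeCellRadical (K := F) c) where
  toFun x := ⟨m * x * m⁻¹, mul_mul_inv_mem_oppositeCellRadical_of_mem hm x.2⟩
  invFun x := ⟨m⁻¹ * x * m, inv_mul_mul_mem_oppositeCellRadical_of_mem hm x.2⟩
  left_inv x := Subtype.ext (by change m⁻¹ * (m * (x : GL (Fin n) F) * m⁻¹) * m = x; group)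
  right_inv x := Subtype.ext (by change m * (m⁻¹ * (x : GL (Fin n) F) * m) * m⁻¹ = x; group)
  map_mul' x y := Subtype.ext (by
    change m * ((x : GL (Fin n) F) * y) * m⁻¹ = m * x * m⁻¹ * (m * y * m⁻¹); group)

omit [ValuativeRel F] [TopologicalSpace F] [IsNonarchimedeanLocalField F] [Fintype α] in
/-- `radicalConj hm x = m x m⁻¹` on matrices. [folklore] -/
@[simp] lemma coe_radicalConj {m : GL (Fin n) F} (hm : m ∈ standardParabolicGL F (⇑toDual ∘ revLabel c))
    (x : ↥(oppositeCellRadical (K := F) c)) :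
    ((radicalConj hm x : ↥(oppositeCellRadical (K := F) c)) : GL (Fin n) F) = m * x * m⁻¹ := rfl

omit [ValuativeRel F] [TopologicalSpace F] [IsNonarchimedeanLocalField F] [Fintype α] in
/-- `(radicalConj hm).symm x = m⁻¹ x m` on matrices. [folklore] -/
@[simp] lemma coe_radicalConj_symm {m : GL (Fin n) F} (hm : m ∈ standardParabolicGL F (⇑toDual ∘ revLabel c))
    (x : ↥(oppositeCellRadical (K := F) c)) :
    (((radicalConj hm).symm x : ↥(oppositeCellRadical (K := F) c)) : GL (Fin n) F) = m⁻¹ * x * m := rfl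

omit [Fintype α] in
/-- `radicalConj hm` is continuous. [folklore] -/
lemma continuous_radicalConj {m : GL (Fin n) F} (hm : m ∈ standardParabolicGL F (⇑toDual ∘ revLabel c)) :
    Continuous (radicalConj (c := c) hm) :=
  Continuous.subtype_mk ((continuous_const.mul continuous_subtype_val).mul continuous_const) _

/-- The conjugate subgroup `m K m⁻¹ ≤ N'` of a subgroup `K ≤ N'`. [folklore] -/
noncomputable def conjSubgroup {m : GL (Fin n) F} (hm : m ∈ standardParabolicGL F (⇑toDual ∘ revLabel c))
    (K : Subgroup ↥(oppositeCellRadical (K := F) c)) : Subgroup ↥(oppositeCellRadical (K := F) c) :=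
  K.map (radicalConj hm).toMonoidHom

omit [ValuativeRel F] [TopologicalSpace F] [IsNonarchimedeanLocalField F] [Fintype α] in
/-- The underlying set of `m K m⁻¹` is the image of `K`. [folklore] -/
lemma coe_conjSubgroup {m : GL (Fin n) F} (hm : m ∈ standardParabolicGL F (⇑toDual ∘ revLabel c))
    (K : Subgroup ↥(oppositeCellRadical (K := F) c)) :
    (conjSubgroup hm K : Set ↥(oppositeCellRadical (K := F) c)) = (radicalConj hm) '' (K : Set _) := rfl

omit [ValuativeRel F] [TopologicalSpace F] [IsNonarchimedeanLocalField F] [Fintype α] in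
/-- Membership in `m K m⁻¹`: `x ∈ m K m⁻¹ ↔ m⁻¹ x m ∈ K`. [folklore] -/
lemma mem_conjSubgroup_iff {m : GL (Fin n) F} (hm : m ∈ standardParabolicGL F (⇑toDual ∘ revLabel c))
    (K : Subgroup ↥(oppositeCellRadical (K := F) c)) (x : ↥(oppositeCellRadical (K := F) c)) :
    x ∈ conjSubgroup hm K ↔ (radicalConj hm).symm x ∈ K :=
  Subgroup.mem_map_equiv

omit [Fintype α] in
/-- `m K m⁻¹` is compact if `K` is. [folklore] -/
lemma isCompact_conjSubgroup {m : GL (Fin n) F} (hm : m ∈ standardParabolicGL F (⇑toDual ∘ revLabel c))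
    {K : Subgroup ↥(oppositeCellRadical (K := F) c)} (hKc : IsCompact (K : Set ↥(oppositeCellRadical (K := F) c))) :
    IsCompact (conjSubgroup hm K : Set ↥(oppositeCellRadical (K := F) c)) := by
  rw [coe_conjSubgroup]
  exact hKc.image (continuous_radicalConj hm)

omit [Fintype α] in
/-- `m K m⁻¹` is open if `K` is. [folklore] -/
lemma isOpen_conjSubgroup {m : GL (Fin n) F} (hm : m ∈ standardParabolicGL F (⇑toDual ∘ revLabel c))
    {K : Subgroup ↥(oppositeCellRadical (K := F) c)} (hKo : IsOpen (K : Set ↥(oppositeCellRadical (K := F) c))) :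
    IsOpen (conjSubgroup hm K : Set ↥(oppositeCellRadical (K := F) c)) := by
  have h : (conjSubgroup hm K : Set ↥(oppositeCellRadical (K := F) c)) =
      (radicalConj (c := c) (Subgroup.inv_mem _ hm)) ⁻¹' (K : Set _) := by
    rw [coe_conjSubgroup]
    ext x
    simp only [Set.mem_image, Set.mem_preimage, SetLike.mem_coe]
    constructor
    · rintro ⟨y, hy, rfl⟩
      have : radicalConj (c := c) (Subgroup.inv_mem _ hm) (radicalConj hm y) = y :=
        Subtype.ext (by simp only [coe_radicalConj, inv_inv]; group)
      rw [this]
      exact hy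
    · intro hx
      refine ⟨_, hx, Subtype.ext ?_⟩
      simp only [coe_radicalConj, inv_inv]
      group
  rw [h]
  exact hKo.preimage (continuous_radicalConj _)

/-- **Right translation by `m ∈ A'`**: `m · Φ_{K,w} = Φ_{m K m⁻¹, σ'(w₀ m w₀⁻¹) w}`. [folklore] -/
theorem smoothIndRep_levi_cellSection (hc : Monotone c) (hσ' : σ'.IsSmooth)
    (K : Subgroup ↥(oppositeCellRadical (K := F) c)) (hKo : IsOpen (K : Set ↥(oppositeCellRadical (K := F) c)))
    (hKc : IsCompact (K : Set ↥(oppositeCellRadical (K := F) c))) (w : W)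
    {m : GL (Fin n) F} (hm : m ∈ cellLeviUnipotent (K := F) c) :
    Representation.smoothIndRep (standardParabolicGL F c) σ' m (cellSection σ' hc hσ' K hKo hKc w) =
      cellSection σ' hc hσ' (conjSubgroup (upperUnitriangular_le_reversedParabolic c hc
          (cellLeviUnipotent_le c hm)) K)
        (isOpen_conjSubgroup _ hKo) (isCompact_conjSubgroup _ hKc)
        (σ' ⟨permGL Fin.revPerm * m * (permGL Fin.revPerm)⁻¹,
          conj_mem_standardParabolicGL_of_mem_cellLeviUnipotent c hm⟩ w) := by
  have hmP' := upperUnitriangular_le_reversedParabolic (K := F) c hc (cellLeviUnipotent_le c hm)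
  apply Representation.SmoothInd.ext
  funext g
  rw [Representation.toFun_smoothIndRep_apply, toFun_cellSection, toFun_cellSection]
  by_cases hg : g ∈ parabolicDoubleCoset (K := F) c Fin.revPerm
  · have hgm : g * m ∈ parabolicDoubleCoset (K := F) c Fin.revPerm :=
      mul_upperUnitriangular_mem_parabolicDoubleCoset_rev hg (cellLeviUnipotent_le c hm)
    obtain ⟨hP, hN⟩ := openCellP_openCellN_mul_levi hc hg hm hgm
    have hNmem : (⟨openCellN hc hgm, openCellN_mem hc hgm⟩ : ↥(oppositeCellRadical (K := F) c)) =
        (radicalConj hmP').symm ⟨openCellN hc hg, openCellN_mem hc hg⟩ := Subtype.ext hN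
    by_cases hK : (radicalConj hmP').symm ⟨openCellN hc hg, openCellN_mem hc hg⟩ ∈ K
    · rw [cellSectionFun_eq_of_mem_cell hc w hgm (by rw [hNmem]; exact hK),
        cellSectionFun_eq_of_mem_cell hc _ hg ((mem_conjSubgroup_iff hmP' K _).2 hK),
        ← Module.End.mul_apply, ← map_mul]
      congr 2
      exact Subtype.ext hP
    · rw [cellSectionFun_eq_zero_of_mem_cell hc w hgm (by rw [hNmem]; exact hK),
        cellSectionFun_eq_zero_of_mem_cell hc _ hg (fun h => hK ((mem_conjSubgroup_iff hmP' K _).1 h))]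
  · have hgm : g * m ∉ parabolicDoubleCoset (K := F) c Fin.revPerm := fun h =>
      hg (mem_parabolicDoubleCoset_rev_of_mul_mem h (cellLeviUnipotent_le c hm))
    rw [cellSectionFun_of_not_mem hc _ w hgm, cellSectionFun_of_not_mem hc _ _ hg]

end Sections

end Literature.NumberTheory.Automorphic
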